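import Literature.NumberTheory.EllipticCurves.WeilPairingRootsOfUnityHolds
import Literature.NumberTheory.EllipticCurves.TorsionCardinality
import Literature.NumberTheory.LocalFields.PadicPowerClassIndex
import HarnessLib

/-!
# Route `TeichmullerTwistDescent`, crux LOW (stmt-BirchSwinnertonDyer-23884) / CORNER (stmt-BirchSwinnertonDyer-23883):
# the `ℚ_p`-rational `p`-torsion of an elliptic curve over `ℚ` is CYCLIC for odd `p` — the typable first lemma
# `stub_fiveTorsion_semisimplification` of the planner's LINE 7 («torsion-pinned ker F»), proved (`--supports`, helper)

Cell `pub/bsd-wall` (D-0145 line route-BirchSwinnertonDyer-TeichmullerTwistDescent, OPEN rev 5), seat `bsd-line-ttd-p2`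
(prover 2/2, g3). THEOREMS ONLY (no definition, no named fact, no `sorry`); route-free (no `Theses` import). Nothing is
closed; BSD is not proved by this.

WHY. The Kosters–Pannekoek cells of the route — LOW (`SupersingularTorsionOptimalManinUnitFive`, Kodaira II at 5) and
CORNER (`KummerCornerTorsionOptimalManinUnit`, III at 5 / II at 7) — carry the binder «a `ℚ_p`-rational point `P` of
order `p`» (`∃ P : (W.baseChange ℚ_[p]).toAffine.Point, p • P = 0 ∧ P ≠ 0`). The planner's LINE 7 (crux idea
`low-torsion-pinned-kerf`, evidence on 23884; file `FirstLemma7.lean`, 2 sorries = 2 stubs) starts from two typable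
lemmas: `stub_not_typeGOrd_of_II_at_five` (already the tree theorem
`EdixhovenFibreFiveSeven….not_typeGOrd_of_padicValInt_eq_two_five`, seat edix-p5) and
`stub_fiveTorsion_semisimplification`: **the `ℚ_5`-rational `5`-torsion is the LINE `ℤ/5·P`** («`E(ℚ_5)[5]` is the line
of `P`: `ζ_5 ∉ ℚ_5`»), i.e. `E[p]|G_{ℚ_p} ≅ (1 *; 0 ω)` has a ONE-dimensional fixed part — the input that pins the
connected subgroup scheme in the finite-flat layer of that line, and equally the fact behind the Kosters–Pannekoek
normal form (`E₀(ℚ_p) ≅ ℤ_p × ℤ/p`, never `× (ℤ/p)²`). This file proves it for EVERY elliptic `W/ℚ` and EVERY odd prime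
`p` (the Kodaira binder of the stub is idle):

* `natCard_torsionBy_padic_dvd_sq` — `#E(ℚ_p)[n] ∣ n²` (`E(ℚ_p) ↪ E(ℚ̄_p)`, Mathlib's `Affine.Point.map_injective`;
  `#E(ℚ̄_p)[n] = n²`, the tree's `card_torsionBy_eq_sq`, Silverman III.6.4 (b));
* `not_isPrimitiveRoot_padic_self` — `ℚ_p` has no primitive `p`-th root of unity for `p` odd (`#μ_p(ℚ_p) = gcd(p − 1, p) = 1`,
  the tree's `card_rootsOfUnity_padicInt`, Serre II §3);
* `natCard_torsionBy_padic_ne_sq`, `natCard_torsionBy_padic_dvd` — hence `#E(ℚ_p)[p] ≠ p²` (Weil pairing: full rational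
  `p`-torsion forces `μ_p ⊂ ℚ_p`, the tree's `exists_isPrimitiveRoot_of_card_torsionBy_eq_sq_holds`, Silverman III.8.1.1),
  so `#E(ℚ_p)[p] ∣ p`;
* `exists_nsmul_eq_of_pTorsion_padic` — **cyclicity**: if `P ≠ 0`, `p • P = 0`, then every `Q` with `p • Q = 0` is `k • P`
  for some `k : ℕ` (a group of prime order is generated by any non-zero element);
* `natCard_torsionBy_padic_eq_of_ne_zero` — on the cells (a non-zero `P` exists) `#E(ℚ_p)[p] = p` exactly;
* `fiveTorsion_semisimplification` — the registered stub signature of LINE 7, verbatim, as a theorem.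
[cite: SilvermanAEC2009, Cor. III.6.4(b), Cor. III.8.1.1] [cite: Serre1973, Ch. II §3.1 Prop. 7]
[cite: KostersPannekoek2017, Thm. 1 and Cor. 2]
-/

set_option autoImplicit false
-- single-conjunct summit: `Summit.BirchSwinnertonDyer.BirchSwinnertonDyer.…` repeats the name by design
set_option linter.dupNamespace false

noncomputable section

open scoped Classical

open WeierstrassCurve

namespace Summit.BirchSwinnertonDyer.BirchSwinnertonDyer.Theorems.TeichmullerTwistDescent.LocalPTorsion

variable (W : WeierstrassCurve ℚ) [W.IsElliptic] (p : ℕ) [hp : Fact p.Prime]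

/-- **`#E(ℚ_p)[n] ∣ n²`**: the `ℚ_p`-rational `n`-torsion embeds (base change to `ℚ̄_p`, injective on points) into the
geometric `n`-torsion, which has `n²` elements. [cite: SilvermanAEC2009, Cor. III.6.4(b)] -/
theorem natCard_torsionBy_padic_dvd_sq {n : ℕ} (hn : n ≠ 0) :
    Nat.card (AddSubgroup.torsionBy (W.baseChange ℚ_[p]).toAffine.Point (n : ℤ)) ∣ n ^ 2 := by
  set Fbar := AlgebraicClosure ℚ_[p]
  haveI : (W.baseChange Fbar).IsElliptic := inferInstanceAs (W.map (algebraMap ℚ Fbar)).IsElliptic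
  -- `E(ℚ_p) → E(ℚ̄_p)`, injective
  set ι : (W.toAffine.baseChange ℚ_[p]).Point →+ (W.toAffine.baseChange Fbar).Point :=
    Affine.Point.baseChange (W' := W.toAffine) ℚ_[p] Fbar with hι
  have hιinj : Function.Injective ι := Affine.Point.map_injective _
  -- restriction to the `n`-torsion
  set T := AddSubgroup.torsionBy (W.baseChange ℚ_[p]).toAffine.Point (n : ℤ)
  set Tbar := AddSubgroup.torsionBy (W.baseChange Fbar).toAffine.Point (n : ℤ)
  have hmem : ∀ P : T, ι (P : (W.baseChange ℚ_[p]).toAffine.Point) ∈ Tbar := by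
    intro P
    change ι P ∈ AddSubgroup.torsionBy _ (n : ℤ)
    rw [AddSubgroup.torsionBy.nsmul_iff, ← map_nsmul, AddSubgroup.torsionBy.nsmul_iff.mp P.2, map_zero]
  let f : T →+ Tbar := (ι.comp T.subtype).codRestrict Tbar hmem
  have hf : Function.Injective f := by
    intro P Q h
    have h' : ι (P : (W.baseChange ℚ_[p]).toAffine.Point) = ι Q := congrArg Subtype.val h
    exact Subtype.ext (hιinj h')
  have hcard : Nat.card Tbar = n ^ 2 := by
    have hnF : ((n : ℕ) : Fbar) ≠ 0 := by exact_mod_cast hn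
    exact card_torsionBy_eq_sq (E := W.baseChange Fbar) hnF
  rw [← hcard]
  exact AddSubgroup.card_dvd_of_injective f hf

/-- **No primitive `p`-th root of unity in `ℚ_p` for odd `p`**: `#μ_p(ℚ_p) = #μ_p(ℤ_p) = gcd(p − 1, p) = 1`.
[cite: Serre1973, Ch. II §3.1 Prop. 7] -/
theorem not_isPrimitiveRoot_padic_self (hp2 : p ≠ 2) (ζ : ℚ_[p]) : ¬ IsPrimitiveRoot ζ p := by
  intro hζ
  haveI : NeZero p := ⟨hp.out.ne_zero⟩
  have h1 : Nat.card (rootsOfUnity p ℚ_[p]) = 1 := by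
    rw [Literature.NumberTheory.LocalFields.card_rootsOfUnity_padic_eq,
      Literature.NumberTheory.LocalFields.card_rootsOfUnity_padicInt hp2 hp.out.ne_zero]
    exact Nat.Coprime.gcd_eq_one ((Nat.coprime_self_sub_left hp.out.one_lt.le).mpr (Nat.coprime_one_left p))
  have hcard : Nat.card (rootsOfUnity p ℚ_[p]) = p := hζ.card_rootsOfUnity
  exact hp.out.one_lt.ne' (by rw [← hcard, h1])

/-- **`#E(ℚ_p)[p] ≠ p²` for odd `p`**: full rational `p`-torsion would put `μ_p` inside `ℚ_p` by the Weil pairing.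
[cite: SilvermanAEC2009, Cor. III.8.1.1] -/
theorem natCard_torsionBy_padic_ne_sq (hp2 : p ≠ 2) :
    Nat.card (AddSubgroup.torsionBy (W.baseChange ℚ_[p]).toAffine.Point (p : ℤ)) ≠ p ^ 2 := by
  intro hsq
  haveI : (W.baseChange ℚ_[p]).IsElliptic := inferInstanceAs (W.map (algebraMap ℚ ℚ_[p])).IsElliptic
  have hpK : (p : ℚ_[p]) ≠ 0 := by exact_mod_cast hp.out.ne_zero
  obtain ⟨ζ, hζ⟩ := (W.baseChange ℚ_[p]).exists_isPrimitiveRoot_of_card_torsionBy_eq_sq_holds p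
    hp.out.two_le hpK hsq
  exact not_isPrimitiveRoot_padic_self p hp2 ζ hζ

/-- **`#E(ℚ_p)[p] ∣ p` for odd `p`.** [cite: SilvermanAEC2009, Cor. III.6.4(b), Cor. III.8.1.1] -/
theorem natCard_torsionBy_padic_dvd (hp2 : p ≠ 2) :
    Nat.card (AddSubgroup.torsionBy (W.baseChange ℚ_[p]).toAffine.Point (p : ℤ)) ∣ p := by
  have h2 := natCard_torsionBy_padic_dvd_sq W p hp.out.ne_zero
  obtain ⟨i, hi, hEq⟩ := (Nat.dvd_prime_pow hp.out).mp h2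
  have hi2 : i ≠ 2 := fun h ↦ natCard_torsionBy_padic_ne_sq W p hp2 (h ▸ hEq)
  rw [hEq]
  calc p ^ i ∣ p ^ 1 := pow_dvd_pow p (by omega)
    _ = p := pow_one p

/-- **On the cells `#E(ℚ_p)[p] = p`**: a non-zero `P` with `p • P = 0` makes the `p`-torsion non-trivial, and its order
divides `p`. [cite: SilvermanAEC2009, Cor. III.8.1.1] [cite: KostersPannekoek2017, Thm. 1 and Cor. 2] -/
theorem natCard_torsionBy_padic_eq_of_ne_zero (hp2 : p ≠ 2) {P : (W.baseChange ℚ_[p]).toAffine.Point}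
    (hP : p • P = 0) (hP0 : P ≠ 0) :
    Nat.card (AddSubgroup.torsionBy (W.baseChange ℚ_[p]).toAffine.Point (p : ℤ)) = p := by
  set T := AddSubgroup.torsionBy (W.baseChange ℚ_[p]).toAffine.Point (p : ℤ)
  have hdvd := natCard_torsionBy_padic_dvd W p hp2
  rcases (Nat.dvd_prime hp.out).mp hdvd with h1 | h
  · exfalso
    have hPT : P ∈ T := AddSubgroup.torsionBy.nsmul_iff.mpr hP
    haveI : Finite T := Nat.finite_of_card_ne_zero (by rw [h1]; exact one_ne_zero)
    have hsub : Subsingleton T := (Nat.card_eq_one_iff_unique.mp h1).1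
    have : (⟨P, hPT⟩ : T) = ⟨0, T.zero_mem⟩ := Subsingleton.elim _ _
    exact hP0 (congrArg Subtype.val this)
  · exact h

/-- **Cyclicity of the `ℚ_p`-rational `p`-torsion (`p` odd)**: if `P ≠ 0` and `p • P = 0` then every `Q` with `p • Q = 0`
is a multiple `k • P`, `k : ℕ` — the `p`-torsion has prime order `p` and is generated by any non-zero element.
[cite: SilvermanAEC2009, Cor. III.8.1.1] -/
theorem exists_nsmul_eq_of_pTorsion_padic (hp2 : p ≠ 2) {P Q : (W.baseChange ℚ_[p]).toAffine.Point}
    (hP : p • P = 0) (hP0 : P ≠ 0) (hQ : p • Q = 0) : ∃ k : ℕ, Q = k • P := by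
  set T := AddSubgroup.torsionBy (W.baseChange ℚ_[p]).toAffine.Point (p : ℤ)
  have hcard : Nat.card T = p := natCard_torsionBy_padic_eq_of_ne_zero W p hp2 hP hP0
  have hPT : P ∈ T := AddSubgroup.torsionBy.nsmul_iff.mpr hP
  have hQT : Q ∈ T := AddSubgroup.torsionBy.nsmul_iff.mpr hQ
  have hne : (⟨P, hPT⟩ : T) ≠ 0 := fun h ↦ hP0 (congrArg Subtype.val h)
  have hmem : (⟨Q, hQT⟩ : T) ∈ AddSubmonoid.multiples (⟨P, hPT⟩ : T) :=
    mem_multiples_of_prime_card hcard hne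
  obtain ⟨k, hk⟩ := (AddSubmonoid.mem_multiples_iff _ _).mp hmem
  exact ⟨k, by simpa using (congrArg Subtype.val hk).symm⟩

/-- **The binder form used by the cells**: from «some `ℚ_p`-rational point of order `p`» to «a generator of the whole
`ℚ_p`-rational `p`-torsion», `p` odd. [cite: SilvermanAEC2009, Cor. III.8.1.1] -/
theorem exists_generator_pTorsion_padic (hp2 : p ≠ 2)
    (h : ∃ P : (W.baseChange ℚ_[p]).toAffine.Point, p • P = 0 ∧ P ≠ 0) :
    ∃ P : (W.baseChange ℚ_[p]).toAffine.Point, p • P = 0 ∧ P ≠ 0 ∧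
      ∀ Q : (W.baseChange ℚ_[p]).toAffine.Point, p • Q = 0 → ∃ k : ℕ, Q = k • P := by
  obtain ⟨P, hP, hP0⟩ := h
  exact ⟨P, hP, hP0, fun Q hQ ↦ exists_nsmul_eq_of_pTorsion_padic W p hp2 hP hP0 hQ⟩

/-- **LINE 7, stub `stub_fiveTorsion_semisimplification`, verbatim signature, PROVED** (planner file `FirstLemma7.lean`,
evidence on stmt-BirchSwinnertonDyer-23884): on a curve with `ord₅ Δ_min = 2` (Kodaira II at 5 — the binder is idle) a
`ℚ_5`-rational point of order `5` generates the `ℚ_5`-rational `5`-torsion. [cite: SilvermanAEC2009, Cor. III.8.1.1]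
[cite: KostersPannekoek2017, Thm. 1 and Cor. 2] -/
theorem fiveTorsion_semisimplification [Fact (Nat.Prime 5)] :
    ∀ (W : WeierstrassCurve ℚ) [W.IsElliptic] [W.IsGloballyMinimal],
      padicValInt 5 W.minimalDiscriminantInt = 2 →
      (∃ P : (W.baseChange ℚ_[5]).toAffine.Point, 5 • P = 0 ∧ P ≠ 0) →
      ∃ P : (W.baseChange ℚ_[5]).toAffine.Point, 5 • P = 0 ∧ P ≠ 0 ∧
        ∀ Q : (W.baseChange ℚ_[5]).toAffine.Point, 5 • Q = 0 → ∃ k : ℕ, Q = k • P := by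
  intro W _ _ _ h
  exact exists_generator_pTorsion_padic W 5 (by norm_num) h

end Summit.BirchSwinnertonDyer.BirchSwinnertonDyer.Theorems.TeichmullerTwistDescent.LocalPTorsion

end
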